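import Summits.ValiantsHypothesis.ValiantsHypothesis.Theorems.BarrierLeverAnchoredDoorHitsLowerPairsVertexStepInduction

/-!
# Route BarrierLever — item `AnchoredDoorHitsLowerPairs` (stmt-ValiantsHypothesis-22510), line `anchored-peeling`:
# THE VERTEX STEP — the stub statement `Stmt.stub_vertexStep` (named, for registration) and its consequences

Prover file (cell valiant-natproofs, rung V4, 𝒟-side; seat val-np-p2 gen 10; `--supports stmt-ValiantsHypothesis-22510`; answer to planner
valiant-natproofs-p1 g19's offer STATUS 2026-08-27T23:09:06Z «register STEP-1 as a second open stub of the line»).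

THE MECHANISM (memo HOME/val-np-p2/g10/MEMO-A1-final-valnp2-g10.md §3). For an x-vertex `a`, the profile-1 anchored door satisfies the
exact VERTEX-EXPANSION IDENTITY 𝔄₁ = f' + x_a·(D_λ f' + N_a f') (f' = the door with `a` deleted, D_λ = Σ_e λ_e θ_e ∂/∂θ_e a derivation in the
weights of f' with one free parameter per anchor, N_a = Σ_c θ_{ac} e^{φ_{ac}·x'} ⊗ y_c e^{ψ_{ac}·y}); so the rows of the symbolic layout on a
simplicial pair `(R, C)` are the rows of f' on the deletion complex `R₀ = {S ∈ R : a ∉ S}` together with the «link rows»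
`D_λ ρ'_{S₁} + rows of N_a f'`, `S₁ ∈ lk_a R`.  The VERTEX STEP says that the link rows always complete the deletion rows to a basis:

  `Stmt.stub_vertexStep`: if the deletion complex `R₀` has independent rows on `C` — witnessed, as in the line's other stubs, by the
  non-vanishing of `symbolicDet 1` on `(R₀, C₀)` for the lower sub-families `C₀ ⊆ C` of size `|R₀|` — then `symbolicDet 1 h r u w ≠ 0`.

It has NO combinatorial side condition (no star counts, any vertex `a` of `R`), so it is a mechanism for exactly the class the line's open
stub `stub_rigidPairs` has none for; `symbolicDet_one_ne_zero_of_vertexStep` (= the definition-free `…VertexStepInduction.symbolicDet_one_ne_zero_of_vertexStep'`, induction on `r`, base `r ≤ 1` = the landed `stub_base`) turning it into symbolic non-vanishing for EVERY injective simplicial pair at profile 1, every `h` (`h₀ = 0`), and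
`stub_symbolicNonvanishing_of_vertexStep` transports that to the line's registered `Stmt.stub_symbolicNonvanishing` (any profile, via the
monotonicity `symbolicDet_ne_zero_mono` of `…Mono`).  EVIDENCE (not proof): the profile-1 door is alive on all 5 192 857 isomorphism-type pairs
on ≤ 6 × ≤ 6 vertices and on ≈ 70 000 structured / rigid pairs up to 14 vertices (kit j293283, j292728, j293309, …, `--workitem 22510`), and the
stronger single-mechanism specialisations of the step (derivation only; c-dependent shifts only; (D_μ + m_ℓ) with 2|Y| parameters) are alive at the
tested vertex of all 27 887 census pairs (kit j293055, j293378) while the pure multiplication step fails on 1 331 of them.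

WHAT THIS IS NOT: `Stmt.stub_vertexStep` is NOT proved here (it is offered for registration); nothing on crux stmt-ValiantsHypothesis-14610 or
`VP` versus `VNP`.
-/

set_option linter.dupNamespace false

namespace Summit.ValiantsHypothesis.ValiantsHypothesis.Theorems.BarrierLever.AnchoredPeeling

open Finset MvPolynomial

noncomputable section

/-- **VERTEX STEP (stub statement, profile 1).** For every injective simplicial-complex pair `(u, w)` and every x-vertex `a` lying in
some row: if every enumeration `u₀` of the deletion complex `{S ∈ range u : a ∉ S}` paired with every injective lower sub-family `w₀` of
`range w` of the same size has `symbolicDet 1 h r₀ u₀ w₀ ≠ 0` (so the deletion rows are independent on the columns `C`), then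
`symbolicDet 1 h r u w ≠ 0` (the link rows `D_λρ' + N_a·ρ'` of the vertex-expansion identity complete them). -/
def Stmt.stub_vertexStep : Prop :=
  ∀ (h r : ℕ) (u w : Fin r → Finset (Fin h)), Function.Injective u → Function.Injective w →
    IsLowerSet (Set.range u) → IsLowerSet (Set.range w) →
    ∀ (a : Fin h), (∃ i, a ∈ u i) →
      (∀ (r₀ : ℕ) (u₀ w₀ : Fin r₀ → Finset (Fin h)), Function.Injective u₀ → Function.Injective w₀ →
          Set.range u₀ = {S | S ∈ Set.range u ∧ a ∉ S} → Set.range w₀ ⊆ Set.range w → IsLowerSet (Set.range w₀) →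
          symbolicDet 1 h r₀ u₀ w₀ ≠ 0) →
      symbolicDet 1 h r u w ≠ 0


/-- **The vertex step implies profile-1 symbolic non-vanishing on EVERY injective simplicial pair, every `h`** (induction on `r`:
`r ≤ 1` is the landed `stub_base`; otherwise some row has a vertex `a`, the vertex step applies, and its hypothesis is the induction
hypothesis on the strictly smaller deletion pairs). -/
theorem symbolicDet_one_ne_zero_of_vertexStep (H : Stmt.stub_vertexStep) (h : ℕ) :
    ∀ (r : ℕ) (u w : Fin r → Finset (Fin h)), Function.Injective u → Function.Injective w →
      IsLowerSet (Set.range u) → IsLowerSet (Set.range w) → symbolicDet 1 h r u w ≠ 0 :=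
  symbolicDet_one_ne_zero_of_vertexStep' H h

/-- **The vertex step closes the line's stub `Stmt.stub_symbolicNonvanishing`** (with `s = 1`, `h₀ = 0`; any larger profile by
`symbolicDet_ne_zero_mono`). Composition offered to the planner: `Stmt.stub_vertexStep → Stmt.stub_symbolicNonvanishing → (item)`. -/
theorem stub_symbolicNonvanishing_of_vertexStep (H : Stmt.stub_vertexStep) : Stmt.stub_symbolicNonvanishing :=
  ⟨1, 0, fun h _ r u w hu hw hlu hlw => symbolicDet_one_ne_zero_of_vertexStep H h r u w hu hw hlu hlw⟩

/-- The same at any profile `s ≥ 1` (the door 𝔄_s contains 𝔄₁). -/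
theorem symbolicDet_ne_zero_of_vertexStep (H : Stmt.stub_vertexStep) {s : ℕ} (hs : 1 ≤ s) (h r : ℕ)
    (u w : Fin r → Finset (Fin h)) (hu : Function.Injective u) (hw : Function.Injective w)
    (hlu : IsLowerSet (Set.range u)) (hlw : IsLowerSet (Set.range w)) : symbolicDet s h r u w ≠ 0 :=
  symbolicDet_ne_zero_mono hs (symbolicDet_one_ne_zero_of_vertexStep H h r u w hu hw hlu hlw)

end

end Summit.ValiantsHypothesis.ValiantsHypothesis.Theorems.BarrierLever.AnchoredPeeling
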